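import Literature.NumberTheory.Weil1964.AdelicSchwartzDominatedOfDecay
import Literature.NumberTheory.Weil1964.AdelicMetaplecticContinuous
import Literature.NumberTheory.Weil1964.AdelicOperatorsLF
import Literature.NumberTheory.Weil1964.ArchChirpFamilyFourierDominant
import HarnessLib

/-!
# Families of finite type with uniformly bounded archimedean seminorms: images under LF-continuous
# operators (in particular under ONE metaplectic operator) are dominated by one Schwartz–Bruhat function

Topic `NumberTheory/Weil1964`; namespace `Literature.NumberTheory.Weil1964`.  KERNEL mathematics only (theorems;
no definition, no instance, no notation, no named fact, no `sorry`).  Cell `hodgecm-mathlib` FLOOR 0, crux H413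
(stmt-HodgeConjecture-24833), E-2 ∕ SW2 identity road, row SW2c-BOUND letter (DOM) «dominated families», in the
form the Borel-internal reduction with the rational Weyl flip consumes it («RED-B», B-p12 (g19) 2026-08-31):
the family to dominate is `{ω(q_w)(t(y·S_h)Φ) : y ∈ K}`, `K ⊆ 𝔸_F` compact, behind ONE fixed implementer `q_w`.
HC_CM is proved only modulo the printed citations until rung 0 closes — nothing here bears on a summit statement.

[Weil1964, Chap. III n° 41, Lemme 5 p. 194]: for a compact family of metaplectic operators and `Φ ∈ 𝒮(X_A)` the
functions are uniformly majorised by ONE `Φ₀ ∈ 𝒮(X_A)`; Weil's proof uses the continuity of `Mp(X)_A` on the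
inductive-limit topology of `𝒮(X_A)` (n° 39).  The tree's metaplectic group of record `Mp_ψ(W_𝔸)ᶜᵒⁿᵗ` consists
of LF-CONTINUOUS operators (★ `IsLFContinuous`: on every Fréchet piece `𝓢(X_∞) ⊗ Φ_f` a FINITE expansion
`Σ_j A_j φ ⊗ Ψ_j` with continuous `A_j`), which is exactly what carries a family that is «LF-bounded of finite type»

  `Φ_c = Σ_{i ∈ I} φ_{i,c} ⊗ Φ_{f,i}`  (`I` finite, FIXED finite parts `Φ_{f,i} ∈ 𝒮(X_f)`, archimedean parts
  with Schwartz seminorms bounded UNIFORMLY in `c ∈ S`)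

to another such family; and such a family has uniform decay data of every order and one compact set of finite
supports, hence (★ `exists_piSchwartzBruhat_dominating_of_uniform_decay`) ONE real non-negative dominant in
`𝒮(𝔸_Fⁿ)`.

* §1 `exists_uniform_decay_of_sum_tmul`, `exists_piSchwartzBruhat_dominating_of_sum_tmul` — decay data of
  every order ∕ one dominant for a family LF-bounded of finite type;
* §2 `exists_sum_tmul_of_isLFContinuous` — LF-continuous operators preserve the class (B-p09 (g18)'s ★
  `exists_forall_seminorm_le_of_uniform`: a Schwartz CLM preserves uniform seminorm bounds);
  `exists_piSchwartzBruhat_dominating_of_isLFContinuous`; `adelicMpCont.exists_piSchwartzBruhat_dominating_omega_of_sum_tmul`;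
* §3 `exists_sum_tmul_chirpLM` — the chirped family `{t(y·S₀)Φ : y ∈ K}`, `K ⊆ 𝔸_F` compact, is LF-bounded of
  finite type (★ `chirpLM_eq_adelicTensorEnd`; B-p09's ★ `uniform_archSdChar_smul` +
  `exists_seminorm_smulLeftCLM_le_uniform` at the archimedean places; at the finite places `y ↦ ψ_f(q_{yS_f})·Φ_f`
  is locally constant, so takes finitely many values on `K`);
* §4 THE (DOM-w) LETTER: `adelicMpCont.exists_sum_tmul_omega_chirpLM` (structural form = the sheet's (D-E):
  finitely many finite parts, uniformly bounded archimedean seminorms), `adelicMpCont.exists_uniform_decay_omega_chirpLM`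
  ((D-θ): decay data of every order + one compact set of finite parts) and
  `adelicMpCont.exists_piSchwartzBruhat_dominating_omega_chirpLM` (one dominant `Φ₀`), for
  `{ω(q)(t(y·S₀)Φ) : y ∈ K}` behind ANY `q ∈ Mp_ψ(W_𝔸)ᶜᵒⁿᵗ`.

## References
* A. Weil, *Sur certains groupes d'opérateurs unitaires*, Acta Math. 111 (1964), Chap. I n° 11 (the topology of
  `𝒮(X)`), Chap. III n° 39 p. 189, n° 41 Lemme 5 p. 194. [Weil1964]
* A. Weil, *Sur la formule de Siegel dans la théorie des groupes classiques*, Acta Math. 113 (1965), n° 49–50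
  (the reduction step of the boundedness argument). [Weil1965]
* L. Hörmander, *The Analysis of Linear Partial Differential Operators I*, 2nd ed. (1990), §7.1. [HormanderALPDO1]
-/

set_option autoImplicit false

noncomputable section

open scoped BigOperators NNReal Matrix Topology Classical TensorProduct SchwartzMap
open NumberField NumberField.mixedEmbedding IsDedekindDomain Set Filter TensorProduct

namespace Literature.NumberTheory.Weil1964

open Literature.NumberTheory.Automorphic Literature.Analysis.Distribution

variable (F : Type) [Field F] [NumberField F] {n : ℕ}

/-! ## §0 Two topological preliminaries -/

section Prelim

variable {X Y : Type*} [TopologicalSpace X]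

/-- A locally constant function takes finitely many values on a compact set (finite subcover by open fibres).
[folklore] -/
private theorem finite_image_of_isLocallyConstant_of_isCompact {g : X → Y} (hg : IsLocallyConstant g) {K : Set X}
    (hK : IsCompact K) : (g '' K).Finite := by
  obtain ⟨t, -, hcover⟩ := hK.elim_nhds_subcover (fun x => g ⁻¹' {g x})
    fun x _ => (hg.isOpen_fiber (g x)).mem_nhds rfl
  refine ((t.finite_toSet).image g).subset ?_
  rintro _ ⟨x, hx, rfl⟩
  obtain ⟨x₀, hx₀, hx'⟩ := Set.mem_iUnion₂.1 (hcover hx)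
  exact ⟨x₀, hx₀, (show g x = g x₀ from hx').symm⟩

end Prelim

/-! ## §1 Families LF-bounded of finite type: uniform decay data and one dominant -/

section FiniteType

variable {ι' : Type*} {S : Set ι'}

/-- **Uniform decay data of every order for a family LF-bounded of finite type.**  If
`Φ_c = Σ_i φ_{i,c} ⊗ Φ_{f,i}` (`c ∈ S`) with fixed finite parts `Φ_{f,i} ∈ 𝒮((𝔸_F^∞)ⁿ)` and archimedean parts
whose Schwartz seminorms are bounded uniformly in `c`, then for every order `k` ONE constant `M_k` gives
`|Φ_c(x)| ≤ M_k (1 + ‖x_∞‖)^{-k}`, and all `Φ_c` vanish off ONE compact set of finite parts (the union of the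
supports of the `Φ_{f,i}`). [cite: Weil1964, Chap. III n° 41, Lemme 5 p. 194] -/
theorem exists_uniform_decay_of_sum_tmul {I : Type*} [Fintype I]
    (φ : I → ι' → 𝓢((Fin n → mixedSpace F), ℂ)) (Φf : I → FinSB F (Fin n))
    (f : ι' → piSchwartzBruhat F (Fin n))
    (hf : ∀ c ∈ S, f c = ∑ i, piSchwartzBruhatEquiv F (Fin n) (φ i c ⊗ₜ[ℂ] Φf i))
    (hφ : ∀ i, ∀ m : ℕ × ℕ, ∃ B : ℝ, ∀ c ∈ S, SchwartzMap.seminorm ℂ m.1 m.2 (φ i c) ≤ B) :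
    ∃ (M : ℕ → ℝ) (Cf : Set (Fin n → FiniteAdeleRing (𝓞 F) F)), IsCompact Cf ∧
      (∀ k : ℕ, ∀ c ∈ S, ∀ x,
        ‖((f c : piSchwartzBruhat F (Fin n)) : (Fin n → AdeleRing (𝓞 F) F) → ℂ) x‖ ≤
          M k * (1 + ‖vecInfinitePart F n x‖) ^ (-(k : ℝ))) ∧
      ∀ c ∈ S, ∀ x, vecFinitePart F n x ∉ Cf →
        ((f c : piSchwartzBruhat F (Fin n)) : (Fin n → AdeleRing (𝓞 F) F) → ℂ) x = 0 := by
  -- finite parts: bounded and compactly supported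
  have hB : ∀ i, ∃ B : ℝ, 0 ≤ B ∧
      ∀ b, ‖((Φf i : FinSB F (Fin n)) : (Fin n → FiniteAdeleRing (𝓞 F) F) → ℂ) b‖ ≤ B := by
    intro i
    obtain ⟨hlc, hcs⟩ := (mem_schwartzBruhat_iff).1 (Φf i).2
    obtain ⟨B, hB⟩ := hcs.exists_bound_of_continuous hlc.continuous
    exact ⟨max B 0, le_max_right _ _, fun b => (hB b).trans (le_max_left _ _)⟩
  choose B hB0 hB using hB
  -- archimedean parts: uniform rapid decay of every order
  have hA : ∀ (i : I) (k : ℕ), ∃ C : ℝ, 0 ≤ C ∧ ∀ c ∈ S, ∀ ξ : Fin n → mixedSpace F,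
      ‖φ i c ξ‖ ≤ C * (1 + ‖ξ‖) ^ (-(k : ℝ)) := by
    intro i k
    obtain ⟨C, hC⟩ := exists_forall_norm_mul_pow_le_of_uniform (𝕜 := ℂ)
      (ContinuousLinearMap.id ℂ 𝓢((Fin n → mixedSpace F), ℂ)) (hφ i) k
    refine ⟨max C 0, le_max_right _ _, fun c hc ξ => ?_⟩
    have h := hC c hc ξ
    rw [ContinuousLinearMap.coe_id', id_eq] at h
    have hpos : 0 < (1 + ‖ξ‖) ^ k := by positivity
    rw [Real.rpow_neg (by positivity), Real.rpow_natCast, ← div_eq_mul_inv, le_div_iff₀ hpos, mul_comm]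
    exact h.trans (le_max_left _ _)
  choose C hC0 hC using hA
  -- the value of `f c` at `x`
  have hval : ∀ c ∈ S, ∀ x, ((f c : piSchwartzBruhat F (Fin n)) : (Fin n → AdeleRing (𝓞 F) F) → ℂ) x =
      ∑ i, φ i c (piArch F (Fin n) x) *
        ((Φf i : FinSB F (Fin n)) : (Fin n → FiniteAdeleRing (𝓞 F) F) → ℂ) (piFinite F (Fin n) x) := by
    intro c hc x
    rw [hf c hc, AddSubmonoidClass.coe_finsetSum, Finset.sum_apply]
    exact Finset.sum_congr rfl fun i _ => by rw [coe_piSchwartzBruhatEquiv_tmul]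
  refine ⟨fun k => ∑ i, C i k * B i,
    ⋃ i, tsupport (((Φf i : FinSB F (Fin n)) : (Fin n → FiniteAdeleRing (𝓞 F) F) → ℂ)),
    isCompact_iUnion fun i => ((mem_schwartzBruhat_iff).1 (Φf i).2).2, fun k c hc x => ?_, fun c hc x hx => ?_⟩
  · rw [hval c hc x, Finset.sum_mul]
    refine (norm_sum_le _ _).trans (Finset.sum_le_sum fun i _ => ?_)
    rw [norm_mul]
    calc ‖φ i c (piArch F (Fin n) x)‖ *
          ‖((Φf i : FinSB F (Fin n)) : (Fin n → FiniteAdeleRing (𝓞 F) F) → ℂ) (piFinite F (Fin n) x)‖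
        ≤ C i k * (1 + ‖vecInfinitePart F n x‖) ^ (-(k : ℝ)) * B i :=
          mul_le_mul (hC i k c hc _) (hB i _) (norm_nonneg _) (mul_nonneg (hC0 i k) (by positivity))
      _ = C i k * B i * (1 + ‖vecInfinitePart F n x‖) ^ (-(k : ℝ)) := by ring
  · rw [hval c hc x]
    refine Finset.sum_eq_zero fun i _ => ?_
    have hx' : piFinite F (Fin n) x ∉
        tsupport (((Φf i : FinSB F (Fin n)) : (Fin n → FiniteAdeleRing (𝓞 F) F) → ℂ)) :=
      fun h => hx (Set.mem_iUnion.2 ⟨i, h⟩)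
    rw [image_eq_zero_of_notMem_tsupport hx', mul_zero]

/-- **One dominant for a family LF-bounded of finite type**: under the hypotheses of
`exists_uniform_decay_of_sum_tmul` there is a real non-negative `Φ₀ ∈ 𝒮(𝔸_Fⁿ)` with `|Φ_c(x)| ≤ Φ₀(x)` for all
`c ∈ S` and all `x` (★ `exists_piSchwartzBruhat_dominating_of_uniform_decay`).
[cite: Weil1964, Chap. III n° 41, Lemme 5 p. 194] -/
theorem exists_piSchwartzBruhat_dominating_of_sum_tmul {I : Type*} [Fintype I]
    (φ : I → ι' → 𝓢((Fin n → mixedSpace F), ℂ)) (Φf : I → FinSB F (Fin n))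
    (f : ι' → piSchwartzBruhat F (Fin n))
    (hf : ∀ c ∈ S, f c = ∑ i, piSchwartzBruhatEquiv F (Fin n) (φ i c ⊗ₜ[ℂ] Φf i))
    (hφ : ∀ i, ∀ m : ℕ × ℕ, ∃ B : ℝ, ∀ c ∈ S, SchwartzMap.seminorm ℂ m.1 m.2 (φ i c) ≤ B) :
    ∃ Φ₀ : (Fin n → AdeleRing (𝓞 F) F) → ℂ, Φ₀ ∈ piSchwartzBruhat F (Fin n) ∧
      (∀ x, (Φ₀ x).im = 0 ∧ 0 ≤ (Φ₀ x).re) ∧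
        ∀ c ∈ S, ∀ x, ‖((f c : piSchwartzBruhat F (Fin n)) : (Fin n → AdeleRing (𝓞 F) F) → ℂ) x‖ ≤ (Φ₀ x).re := by
  obtain ⟨M, Cf, hCf, hd, hs⟩ := exists_uniform_decay_of_sum_tmul F φ Φf f hf hφ
  exact exists_piSchwartzBruhat_dominating_of_uniform_decay F (T := S)
    (fun c => ((f c : piSchwartzBruhat F (Fin n)) : (Fin n → AdeleRing (𝓞 F) F) → ℂ)) M hCf hd hs

end FiniteType

/-! ## §2 LF-continuous operators preserve the class -/

section LFImage

variable {ι' : Type*} {S : Set ι'}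

/-- **An LF-continuous operator carries a family LF-bounded of finite type to another one**: expand `M` on each of
the finitely many Fréchet pieces `𝓢(X_∞) ⊗ Φ_{f,i}` (★ `IsLFContinuous`) and transport the uniform seminorm bounds
through the continuous coefficients `A_j` (★ `exists_forall_seminorm_le_of_uniform`).
[cite: Weil1964, Chap. I n° 11 p. 158; HormanderALPDO1, §7.1] -/
theorem exists_sum_tmul_of_isLFContinuous {M : piSchwartzBruhat F (Fin n) →ₗ[ℂ] piSchwartzBruhat F (Fin n)}
    (hM : IsLFContinuous M) {I : Type} [Fintype I]
    (φ : I → ι' → 𝓢((Fin n → mixedSpace F), ℂ)) (Φf : I → FinSB F (Fin n))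
    (f : ι' → piSchwartzBruhat F (Fin n))
    (hf : ∀ c ∈ S, f c = ∑ i, piSchwartzBruhatEquiv F (Fin n) (φ i c ⊗ₜ[ℂ] Φf i))
    (hφ : ∀ i, ∀ m : ℕ × ℕ, ∃ B : ℝ, ∀ c ∈ S, SchwartzMap.seminorm ℂ m.1 m.2 (φ i c) ≤ B) :
    ∃ (J : Type) (_ : Fintype J) (ψ : J → ι' → 𝓢((Fin n → mixedSpace F), ℂ)) (Ψf : J → FinSB F (Fin n)),
      (∀ c ∈ S, M (f c) = ∑ j, piSchwartzBruhatEquiv F (Fin n) (ψ j c ⊗ₜ[ℂ] Ψf j)) ∧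
      ∀ j, ∀ m : ℕ × ℕ, ∃ B : ℝ, ∀ c ∈ S, SchwartzMap.seminorm ℂ m.1 m.2 (ψ j c) ≤ B := by
  choose κ instκ A Ψ hexp using fun i => hM (Φf i)
  letI : ∀ i, Fintype (κ i) := instκ
  refine ⟨(i : I) × κ i, inferInstance, fun j c => A j.1 j.2 (φ j.1 c), fun j => Ψ j.1 j.2,
    fun c hc => ?_, fun j m => ?_⟩
  · rw [hf c hc, map_sum, Fintype.sum_sigma]
    exact Finset.sum_congr rfl fun i _ => (hexp i (φ i c)).trans rfl
  · exact exists_forall_seminorm_le_of_uniform (𝕜 := ℂ) (A j.1 j.2) (hφ j.1) m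

/-- **One dominant behind an LF-continuous operator**: for `M` LF-continuous and a family `Φ_c` LF-bounded of
finite type there is a real non-negative `Φ₀ ∈ 𝒮(𝔸_Fⁿ)` with `|(M Φ_c)(x)| ≤ Φ₀(x)` for all `c ∈ S`, `x`.
[cite: Weil1964, Chap. III n° 41, Lemme 5 p. 194] -/
theorem exists_piSchwartzBruhat_dominating_of_isLFContinuous
    {M : piSchwartzBruhat F (Fin n) →ₗ[ℂ] piSchwartzBruhat F (Fin n)} (hM : IsLFContinuous M)
    {I : Type} [Fintype I] (φ : I → ι' → 𝓢((Fin n → mixedSpace F), ℂ)) (Φf : I → FinSB F (Fin n))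
    (f : ι' → piSchwartzBruhat F (Fin n))
    (hf : ∀ c ∈ S, f c = ∑ i, piSchwartzBruhatEquiv F (Fin n) (φ i c ⊗ₜ[ℂ] Φf i))
    (hφ : ∀ i, ∀ m : ℕ × ℕ, ∃ B : ℝ, ∀ c ∈ S, SchwartzMap.seminorm ℂ m.1 m.2 (φ i c) ≤ B) :
    ∃ Φ₀ : (Fin n → AdeleRing (𝓞 F) F) → ℂ, Φ₀ ∈ piSchwartzBruhat F (Fin n) ∧
      (∀ x, (Φ₀ x).im = 0 ∧ 0 ≤ (Φ₀ x).re) ∧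
        ∀ c ∈ S, ∀ x, ‖((M (f c) : piSchwartzBruhat F (Fin n)) : (Fin n → AdeleRing (𝓞 F) F) → ℂ) x‖ ≤
          (Φ₀ x).re := by
  obtain ⟨J, _, ψ, Ψf, hMf, hψ⟩ := exists_sum_tmul_of_isLFContinuous F hM φ Φf f hf hφ
  exact exists_piSchwartzBruhat_dominating_of_sum_tmul F ψ Ψf (fun c => M (f c)) hMf hψ

variable {T : Matrix (Fin n) (Fin n) (AdeleRing (𝓞 F) F)}

/-- **One dominant behind ONE metaplectic operator**: for `q ∈ Mp_ψ(W_𝔸)ᶜᵒⁿᵗ` (its Weil operator is LF-continuous,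
★ `adelicMpCont.isLFContinuous_omega`) and a family `Φ_c` LF-bounded of finite type, ONE real non-negative
`Φ₀ ∈ 𝒮(𝔸_Fⁿ)` dominates all `ω(q)Φ_c`, `c ∈ S`. [cite: Weil1964, Chap. III n° 39 p. 189, n° 41 Lemme 5 p. 194] -/
theorem adelicMpCont.exists_piSchwartzBruhat_dominating_omega_of_sum_tmul (q : adelicMpCont F (Fin n) T)
    {I : Type} [Fintype I] (φ : I → ι' → 𝓢((Fin n → mixedSpace F), ℂ)) (Φf : I → FinSB F (Fin n))
    (f : ι' → piSchwartzBruhat F (Fin n))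
    (hf : ∀ c ∈ S, f c = ∑ i, piSchwartzBruhatEquiv F (Fin n) (φ i c ⊗ₜ[ℂ] Φf i))
    (hφ : ∀ i, ∀ m : ℕ × ℕ, ∃ B : ℝ, ∀ c ∈ S, SchwartzMap.seminorm ℂ m.1 m.2 (φ i c) ≤ B) :
    ∃ Φ₀ : (Fin n → AdeleRing (𝓞 F) F) → ℂ, Φ₀ ∈ piSchwartzBruhat F (Fin n) ∧
      (∀ x, (Φ₀ x).im = 0 ∧ 0 ≤ (Φ₀ x).re) ∧
        ∀ c ∈ S, ∀ x, ‖((adelicMpCont.omega F (Fin n) T q (f c) : piSchwartzBruhat F (Fin n)) :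
          (Fin n → AdeleRing (𝓞 F) F) → ℂ) x‖ ≤ (Φ₀ x).re :=
  exists_piSchwartzBruhat_dominating_of_isLFContinuous F (adelicMpCont.isLFContinuous_omega q) φ Φf f hf hφ

end LFImage

/-! ## §3 The chirped family `{t(y·S₀)Φ : y ∈ K}` is LF-bounded of finite type -/

section Chirp

/-- Every `Φ ∈ 𝒮(𝔸_Fⁿ) = 𝓢(X_∞) ⊗ 𝒮(X_f)` is a finite sum of pure tensors indexed by a finite TYPE
(`TensorProduct.exists_finset` through ★ `piSchwartzBruhatEquiv`). [folklore] -/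
private theorem exists_sum_tmul_of_mem (Φ : piSchwartzBruhat F (Fin n)) :
    ∃ (I : Type) (_ : Fintype I) (φ : I → 𝓢((Fin n → mixedSpace F), ℂ)) (Φf : I → FinSB F (Fin n)),
      Φ = ∑ i, piSchwartzBruhatEquiv F (Fin n) (φ i ⊗ₜ[ℂ] Φf i) := by
  obtain ⟨s, hs⟩ := TensorProduct.exists_finset ((piSchwartzBruhatEquiv F (Fin n)).symm Φ)
  refine ⟨↥s, inferInstance, fun p => p.1.1, fun p => p.1.2, ?_⟩
  have h : Φ = piSchwartzBruhatEquiv F (Fin n) (∑ p ∈ s, p.1 ⊗ₜ[ℂ] p.2) := by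
    rw [← hs, LinearEquiv.apply_symm_apply]
  rw [h, map_sum]
  exact (Finset.sum_coe_sort s fun p => piSchwartzBruhatEquiv F (Fin n) (p.1 ⊗ₜ[ℂ] p.2)).symm

/-- The archimedean coordinate map `archHom : 𝔸_F → F ⊗ ℝ` is continuous. [folklore] -/
private theorem continuous_archHom : Continuous (archHom F) :=
  (continuous_ringEquiv_mixedSpace (K := F)).comp continuous_fst

/-- Entrywise image of a scalar multiple of a matrix under a ring homomorphism. [folklore] -/
private theorem matrix_map_smul_ringHom {R R' : Type*} [CommSemiring R] [CommSemiring R'] (g : R →+* R') (y : R)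
    (A : Matrix (Fin n) (Fin n) R) : (y • A).map g = g y • A.map g := by
  ext i j
  simp only [Matrix.map_apply, Matrix.smul_apply, smul_eq_mul, map_mul]

/-- `q_{y·T}(b) = y · q_T(b)` for the finite second-degree form. [folklore] -/
private theorem finSdForm_smul (y : FiniteAdeleRing (𝓞 F) F) (T₁ : Matrix (Fin n) (Fin n) (FiniteAdeleRing (𝓞 F) F))
    (b : Fin n → FiniteAdeleRing (𝓞 F) F) : finSdForm (y • T₁) b = y * finSdForm T₁ b := by
  rw [finSdForm_apply, finSdForm_apply, Matrix.vecMul_smul, smul_dotProduct, smul_eq_mul]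

/-- **The finite chirp of a fixed `Φ_f ∈ 𝒮((𝔸_F^∞)ⁿ)` is locally constant in the parameter**: `y ↦ ψ_f(q_{(yS₀)_f}) Φ_f`
is locally constant on `𝔸_F` (`ψ_f` is locally constant, the support of `Φ_f` is compact: tube lemma).
[cite: Weil1964, Chap. I n° 34 p. 184] -/
theorem isLocallyConstant_finMulLM_finSdChar (S₀ : Matrix (Fin n) (Fin n) (AdeleRing (𝓞 F) F)) (Φf : FinSB F (Fin n)) :
    IsLocallyConstant fun y : AdeleRing (𝓞 F) F =>
      finMulLM (finSdChar ((y • S₀).map (RingHom.snd (InfiniteAdeleRing F) (FiniteAdeleRing (𝓞 F) F))))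
        (isLocallyConstant_finSdChar _) Φf := by
  set Sf : Matrix (Fin n) (Fin n) (FiniteAdeleRing (𝓞 F) F) :=
    S₀.map (RingHom.snd (InfiniteAdeleRing F) (FiniteAdeleRing (𝓞 F) F)) with hSf
  have hform : ∀ (y : AdeleRing (𝓞 F) F) (b : Fin n → FiniteAdeleRing (𝓞 F) F),
      finSdForm ((y • S₀).map (RingHom.snd (InfiniteAdeleRing F) (FiniteAdeleRing (𝓞 F) F))) b =
        y.2 * finSdForm Sf b := by
    intro y b
    rw [show (y • S₀).map (RingHom.snd (InfiniteAdeleRing F) (FiniteAdeleRing (𝓞 F) F)) = y.2 • Sf from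
      matrix_map_smul_ringHom (RingHom.snd (InfiniteAdeleRing F) (FiniteAdeleRing (𝓞 F) F)) y S₀, finSdForm_smul]
  obtain ⟨-, hcs⟩ := (mem_schwartzBruhat_iff).1 Φf.2
  -- the phase `(y, b) ↦ ψ_f(y_f q(b))` is locally constant on `𝔸_F × (𝔸_F^∞)ⁿ`
  have hg : IsLocallyConstant fun z : AdeleRing (𝓞 F) F × (Fin n → FiniteAdeleRing (𝓞 F) F) =>
      (finiteAdeleAddChar F (z.1.2 * finSdForm Sf z.2) : ℂ) :=
    (isLocallyConstant_finiteAdeleAddChar F).comp_continuous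
      ((continuous_snd.comp continuous_fst).mul ((continuous_finSdForm Sf).comp continuous_snd))
  refine (IsLocallyConstant.iff_eventually_eq _).2 fun y₀ => ?_
  have hev : ∀ᶠ y in 𝓝 y₀, ∀ b ∈ tsupport ((Φf : FinSB F (Fin n)) : (Fin n → FiniteAdeleRing (𝓞 F) F) → ℂ),
      (finiteAdeleAddChar F (y.2 * finSdForm Sf b) : ℂ) = (finiteAdeleAddChar F (y₀.2 * finSdForm Sf b) : ℂ) := by
    refine IsCompact.eventually_forall_of_forall_eventually hcs fun b _ => ?_
    have h1 := hg.eventually_eq (y₀, b)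
    have h2 := (hg.comp_continuous ((continuous_const (y := y₀)).prodMk continuous_snd)).eventually_eq (y₀, b)
    filter_upwards [h1, h2] with z hz1 hz2
    exact hz1.trans hz2.symm
  filter_upwards [hev] with y hy
  apply Subtype.ext
  funext b
  change finSdChar _ b * _ = finSdChar _ b * _
  simp only [finSdChar, hform]
  by_cases hb : b ∈ tsupport ((Φf : FinSB F (Fin n)) : (Fin n → FiniteAdeleRing (𝓞 F) F) → ℂ)
  · rw [hy b hb]
  · rw [image_eq_zero_of_notMem_tsupport hb, mul_zero, mul_zero]

/-- **The chirped family `{t(y·S₀)Φ : y ∈ K}`, `K ⊆ 𝔸_F` compact, is LF-bounded of finite type**: finitely many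
FIXED finite parts and archimedean parts `𝐞(-q_{y_∞T₀})φ_i` with Schwartz seminorms bounded uniformly in `y ∈ K`
(★ `chirpLM_eq_adelicTensorEnd`, ★ `uniform_archSdChar_smul`, ★ `exists_seminorm_smulLeftCLM_le_uniform`;
the finite chirps take finitely many values on `K`). [cite: Weil1964, Chap. III n° 41, Lemme 5 p. 194]
[cite: HormanderALPDO1, §7.1] -/
theorem exists_sum_tmul_chirpLM (Φ : piSchwartzBruhat F (Fin n)) (S₀ : Matrix (Fin n) (Fin n) (AdeleRing (𝓞 F) F))
    {K : Set (AdeleRing (𝓞 F) F)} (hK : IsCompact K) :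
    ∃ (J : Type) (_ : Fintype J) (ψ : J → AdeleRing (𝓞 F) F → 𝓢((Fin n → mixedSpace F), ℂ))
      (Ψf : J → FinSB F (Fin n)),
      (∀ y ∈ K, chirpLM F (y • S₀) Φ = ∑ j, piSchwartzBruhatEquiv F (Fin n) (ψ j y ⊗ₜ[ℂ] Ψf j)) ∧
      ∀ j, ∀ m : ℕ × ℕ, ∃ B : ℝ, ∀ y ∈ K, SchwartzMap.seminorm ℂ m.1 m.2 (ψ j y) ≤ B := by
  obtain ⟨I, _, φ, Φf, hΦ⟩ := exists_sum_tmul_of_mem F Φ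
  set T₀ : Matrix (Fin n) (Fin n) (mixedSpace F) := S₀.map (archHom F) with hT₀
  -- archimedean and finite parts of `t(y·S₀)(φ_i ⊗ Φ_{f,i})`
  set arch : I → AdeleRing (𝓞 F) F → 𝓢((Fin n → mixedSpace F), ℂ) :=
    fun i y => archSdCharCLM F ((y • S₀).map (archHom F)) (φ i) with harch_def
  set fin : I → AdeleRing (𝓞 F) F → FinSB F (Fin n) := fun i y =>
    finMulLM (finSdChar ((y • S₀).map (RingHom.snd (InfiniteAdeleRing F) (FiniteAdeleRing (𝓞 F) F))))
      (isLocallyConstant_finSdChar _) (Φf i) with hfin_def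
  have hact : ∀ y, chirpLM F (y • S₀) Φ = ∑ i, piSchwartzBruhatEquiv F (Fin n) (arch i y ⊗ₜ[ℂ] fin i y) := by
    intro y
    rw [hΦ, map_sum]
    refine Finset.sum_congr rfl fun i _ => ?_
    rw [chirpLM_eq_adelicTensorEnd, adelicTensorEnd_apply_tmul]
    rfl
  -- finitely many finite parts on `K`
  have hV : ∀ i, ((fin i) '' K).Finite := fun i =>
    finite_image_of_isLocallyConstant_of_isCompact (isLocallyConstant_finMulLM_finSdChar F S₀ (Φf i)) hK
  letI : ∀ i, Fintype ↥((fin i) '' K) := fun i => (hV i).fintype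
  -- uniform seminorm bounds of the archimedean parts
  have hKinf : IsCompact (archHom F '' K) := hK.image (continuous_archHom F)
  obtain ⟨R₀, hR₀⟩ := hKinf.isBounded.exists_norm_le
  obtain ⟨hsm, hbd⟩ := uniform_archSdChar_smul F T₀ (le_max_right R₀ 0) (K := archHom F '' K)
    fun β hβ => (hR₀ β hβ).trans (le_max_left _ _)
  have hbound : ∀ i, ∀ m : ℕ × ℕ, ∃ B : ℝ, 0 ≤ B ∧ ∀ y ∈ K, SchwartzMap.seminorm ℂ m.1 m.2 (arch i y) ≤ B := by
    intro i m
    obtain ⟨s, C', hC', hb⟩ := exists_seminorm_smulLeftCLM_le_uniform (𝕜 := ℂ) (E := ℂ)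
      (g := fun β : mixedSpace F => archSdChar F (β • T₀)) hsm hbd m.1 m.2
    refine ⟨C' * (s.sup (schwartzSeminormFamily ℂ (Fin n → mixedSpace F) ℂ)) (φ i),
      mul_nonneg hC' (apply_nonneg _ _), fun y hy => ?_⟩
    have hmap : (y • S₀).map (archHom F) = archHom F y • T₀ := matrix_map_smul_ringHom (archHom F) y S₀
    show SchwartzMap.seminorm ℂ m.1 m.2 (archSdCharCLM F ((y • S₀).map (archHom F)) (φ i)) ≤ _
    rw [hmap]
    exact hb (archHom F y) (Set.mem_image_of_mem _ hy) (φ i)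
  choose B hB0 hB using hbound
  refine ⟨(i : I) × ↥((fin i) '' K), inferInstance,
    fun j y => if fin j.1 y = (j.2 : FinSB F (Fin n)) then arch j.1 y else 0,
    fun j => (j.2 : FinSB F (Fin n)), fun y hy => ?_, fun j m => ⟨B j.1 m, fun y hy => ?_⟩⟩
  · rw [hact y, Fintype.sum_sigma]
    refine Finset.sum_congr rfl fun i _ => ?_
    rw [Fintype.sum_eq_single (⟨fin i y, Set.mem_image_of_mem _ hy⟩ : ↥((fin i) '' K)) ?_]
    · dsimp only
      rw [if_pos rfl]
    · intro v hv
      have hne : fin i y ≠ (v : FinSB F (Fin n)) := fun h => hv (Subtype.ext h.symm)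
      dsimp only
      rw [if_neg hne, TensorProduct.zero_tmul, map_zero]
  · dsimp only
    by_cases h : fin j.1 y = (j.2 : FinSB F (Fin n))
    · rw [if_pos h]
      exact hB j.1 m y hy
    · rw [if_neg h, map_zero]
      exact hB0 j.1 m

end Chirp

/-! ## §4 The (DOM-w) letter: `{ω(q)(t(y·S₀)Φ) : y ∈ K}` behind one metaplectic operator -/

section Letter

variable {T : Matrix (Fin n) (Fin n) (AdeleRing (𝓞 F) F)}

/-- **(DOM-w), structural form** (the sheet's (D-E)): for `q ∈ Mp_ψ(W_𝔸)ᶜᵒⁿᵗ`, `Φ ∈ 𝒮(𝔸_Fⁿ)`, `S₀ ∈ M_n(𝔸_F)` and a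
compact `K ⊆ 𝔸_F`, the family `{ω(q)(t(y·S₀)Φ) : y ∈ K}` has finitely many FIXED finite parts and archimedean parts
with Schwartz seminorms bounded uniformly in `y ∈ K`. [cite: Weil1964, Chap. III n° 39 p. 189, n° 41 Lemme 5 p. 194]
[cite: Weil1965, n° 49–50] -/
theorem adelicMpCont.exists_sum_tmul_omega_chirpLM (q : adelicMpCont F (Fin n) T) (Φ : piSchwartzBruhat F (Fin n))
    (S₀ : Matrix (Fin n) (Fin n) (AdeleRing (𝓞 F) F)) {K : Set (AdeleRing (𝓞 F) F)} (hK : IsCompact K) :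
    ∃ (J : Type) (_ : Fintype J) (ψ : J → AdeleRing (𝓞 F) F → 𝓢((Fin n → mixedSpace F), ℂ))
      (Ψf : J → FinSB F (Fin n)),
      (∀ y ∈ K, adelicMpCont.omega F (Fin n) T q (chirpLM F (y • S₀) Φ) =
        ∑ j, piSchwartzBruhatEquiv F (Fin n) (ψ j y ⊗ₜ[ℂ] Ψf j)) ∧
      ∀ j, ∀ m : ℕ × ℕ, ∃ B : ℝ, ∀ y ∈ K, SchwartzMap.seminorm ℂ m.1 m.2 (ψ j y) ≤ B := by
  obtain ⟨I, _, φ, Φf, hf, hφ⟩ := exists_sum_tmul_chirpLM F Φ S₀ hK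
  exact exists_sum_tmul_of_isLFContinuous F (adelicMpCont.isLFContinuous_omega q) φ Φf
    (fun y => chirpLM F (y • S₀) Φ) hf hφ

-- the statement (two coerced `ω(q)`-terms and a real power) uses most of the default elaboration budget
set_option maxHeartbeats 400000 in
/-- **(DOM-w), decay form** (the sheet's (D-θ)): ONE compact set of finite parts off which all `ω(q)(t(y·S₀)Φ)`,
`y ∈ K`, vanish, and for every order `k` ONE constant `M_k` with `|ω(q)(t(y·S₀)Φ)(x)| ≤ M_k (1 + ‖x_∞‖)^{-k}`.
[cite: Weil1964, Chap. III n° 41, Lemme 5 p. 194] [cite: Weil1965, n° 49–50] -/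
theorem adelicMpCont.exists_uniform_decay_omega_chirpLM (q : adelicMpCont F (Fin n) T)
    (Φ : piSchwartzBruhat F (Fin n)) (S₀ : Matrix (Fin n) (Fin n) (AdeleRing (𝓞 F) F))
    {K : Set (AdeleRing (𝓞 F) F)} (hK : IsCompact K) :
    ∃ (M : ℕ → ℝ) (Cf : Set (Fin n → FiniteAdeleRing (𝓞 F) F)), IsCompact Cf ∧
      (∀ k : ℕ, ∀ y ∈ K, ∀ x,
        ‖((adelicMpCont.omega F (Fin n) T q (chirpLM F (y • S₀) Φ) : piSchwartzBruhat F (Fin n)) :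
            (Fin n → AdeleRing (𝓞 F) F) → ℂ) x‖ ≤ M k * (1 + ‖vecInfinitePart F n x‖) ^ (-(k : ℝ))) ∧
      ∀ y ∈ K, ∀ x, vecFinitePart F n x ∉ Cf →
        ((adelicMpCont.omega F (Fin n) T q (chirpLM F (y • S₀) Φ) : piSchwartzBruhat F (Fin n)) :
          (Fin n → AdeleRing (𝓞 F) F) → ℂ) x = 0 := by
  obtain ⟨J, _, ψ, Ψf, hf, hψ⟩ := adelicMpCont.exists_sum_tmul_omega_chirpLM F q Φ S₀ hK
  exact exists_uniform_decay_of_sum_tmul F (S := K) ψ Ψf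
    (fun y => adelicMpCont.omega F (Fin n) T q (chirpLM F (y • S₀) Φ)) hf hψ

/-- **(DOM-w), ONE DOMINANT** (Weil's Lemme 5 behind one metaplectic operator): for `q ∈ Mp_ψ(W_𝔸)ᶜᵒⁿᵗ`,
`Φ ∈ 𝒮(𝔸_Fⁿ)`, `S₀ ∈ M_n(𝔸_F)` and a compact `K ⊆ 𝔸_F` there is a real non-negative `Φ₀ ∈ 𝒮(𝔸_Fⁿ)` with
`|ω(q)(t(y·S₀)Φ)(x)| ≤ Φ₀(x)` for all `y ∈ K` and all `x ∈ 𝔸_Fⁿ`.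
[cite: Weil1964, Chap. III n° 41, Lemme 5 p. 194] [cite: Weil1965, n° 49–50] -/
theorem adelicMpCont.exists_piSchwartzBruhat_dominating_omega_chirpLM (q : adelicMpCont F (Fin n) T)
    (Φ : piSchwartzBruhat F (Fin n)) (S₀ : Matrix (Fin n) (Fin n) (AdeleRing (𝓞 F) F))
    {K : Set (AdeleRing (𝓞 F) F)} (hK : IsCompact K) :
    ∃ Φ₀ : (Fin n → AdeleRing (𝓞 F) F) → ℂ, Φ₀ ∈ piSchwartzBruhat F (Fin n) ∧
      (∀ x, (Φ₀ x).im = 0 ∧ 0 ≤ (Φ₀ x).re) ∧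
        ∀ y ∈ K, ∀ x,
          ‖((adelicMpCont.omega F (Fin n) T q (chirpLM F (y • S₀) Φ) : piSchwartzBruhat F (Fin n)) :
              (Fin n → AdeleRing (𝓞 F) F) → ℂ) x‖ ≤ (Φ₀ x).re := by
  obtain ⟨J, _, ψ, Ψf, hf, hψ⟩ := adelicMpCont.exists_sum_tmul_omega_chirpLM F q Φ S₀ hK
  exact exists_piSchwartzBruhat_dominating_of_sum_tmul F ψ Ψf
    (fun y => adelicMpCont.omega F (Fin n) T q (chirpLM F (y • S₀) Φ)) hf hψ

/-- **The chirped family itself is dominated** (no operator: `{t(y·S₀)Φ : y ∈ K}` — also immediate from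
`|t(S)Φ| = |Φ|`, recorded in the same shape for the assembly's case (I)).
[cite: Weil1964, Chap. III n° 41, Lemme 5 p. 194] -/
theorem exists_piSchwartzBruhat_dominating_chirpLM (Φ : piSchwartzBruhat F (Fin n))
    (S₀ : Matrix (Fin n) (Fin n) (AdeleRing (𝓞 F) F)) {K : Set (AdeleRing (𝓞 F) F)} (hK : IsCompact K) :
    ∃ Φ₀ : (Fin n → AdeleRing (𝓞 F) F) → ℂ, Φ₀ ∈ piSchwartzBruhat F (Fin n) ∧
      (∀ x, (Φ₀ x).im = 0 ∧ 0 ≤ (Φ₀ x).re) ∧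
        ∀ y ∈ K, ∀ x,
          ‖((chirpLM F (y • S₀) Φ : piSchwartzBruhat F (Fin n)) : (Fin n → AdeleRing (𝓞 F) F) → ℂ) x‖ ≤
            (Φ₀ x).re := by
  obtain ⟨J, _, ψ, Ψf, hf, hψ⟩ := exists_sum_tmul_chirpLM F Φ S₀ hK
  exact exists_piSchwartzBruhat_dominating_of_sum_tmul F ψ Ψf (fun y => chirpLM F (y • S₀) Φ) hf hψ

end Letter

end Literature.NumberTheory.Weil1964

end
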